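import Mathlib
import HarnessLib

/-!
# The Crouzeix–Raviart interpolation (edge-mean-zero Poincaré) constant on a triangle

Topic `Literature/Analysis/ValidatedNumerics`; statements-first file (two definitions + elementary
consequences, no instances, no notation).

For a triangle `K` with edges `e₁, e₂, e₃` and longest edge length `h_K`, Liu defines
`C(K) := sup { ‖v‖_{L²(K)} / ‖∇v‖_{L²(K)} : v ∈ H¹(K), ∫_{eᵢ} v ds = 0 (i = 1,2,3) }`
[cite: Liu2015, §3.1 eq. (16)] — equivalently the error constant `‖v − Π_h v‖ ≤ C(K)‖∇(v − Π_h v)‖` of the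
Crouzeix–Raviart interpolation `Π_h` (which preserves the three edge means), the constant `C_h` of the
projection-error hypothesis in Liu's guaranteed lower eigenvalue bound (tree:
`Literature.Analysis.OperatorTheory.ProjectionLowerBound.liu_count_bound`, hypothesis `happrox`). Liu proves, by
verified computation on reference triangles plus a perturbation argument, `C(K) ≤ 0.1893·h_K` for EVERY triangle
[cite: Liu2015, §4 («C(K) ≤ 0.1893h») and §4.3], and quotes the analytic bounds `0.43955·h_K` / `0.2983·h_K` of
Carstensen–Gallistl [cite: Liu2015, Remark 2.2].

This file gives the tree a NAME for that hypothesis, in the vocabulary Mathlib has (no Sobolev spaces on domains):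
* `CRPoincareConstant κ` — the inequality `∫_K f² ≤ κ² h_K² ∫_K |∇f|²` for every non-degenerate triangle
  `K = conv{a, b, c} ⊂ ℝ × ℝ` and every `f ∈ C¹(ℝ²)` whose means over the three edges vanish (edge means as
  parametrised interval integrals; `|∇f|² = (∂₁f)² + (∂₂f)²` written with `fderiv` applied to the coordinate
  vectors — NOT the operator norm of `fderiv` for the sup norm of `ℝ × ℝ`; `h_K²` = the largest squared Euclidean
  edge length; area measure = `volume` on `ℝ × ℝ`). This is the `C¹` SPECIAL CASE of the printed `H¹(K)` statement
  -- TODO(general form): `f ∈ H¹(K)` (the printed class); `C¹(ℝ²)|_K` is dense in it, so the constants agree.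
* `LiuCRConstant` — the NAMED FACT `CRPoincareConstant 0.1893` [cite: Liu2015, §4 and §4.3] (computer-assisted
  proof in the source; hypothesis «H-CR» of certnum's −Δ* eigenvalue brackets, RELEASES l.58).
* `CRPoincareConstant.mono` — monotonicity in `κ` (trivial), whence `crPoincareConstant_of_liu`: Liu's constant
  implies the inequality with the analytic constant `0.2983` (hypothesis «H-CR-A» of RELEASES l.74/l.75; its own
  printed proof is Carstensen–Gallistl 2014, Numer. Math. 126 — primary not held here, acq-13016).
WHAT THIS IS NOT: a proof of either constant; the link from `CRPoincareConstant` to the abstract `happrox` of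
`ProjectionLowerBound` (that needs the finite-element function spaces); anything in 3-D (Liu's `0.3804h`, Thm 3.4).
-/

noncomputable section

namespace Literature.Analysis.ValidatedNumerics

open MeasureTheory Set intervalIntegral

/-- Squared Euclidean length of a plane vector `v = (v₁, v₂)`: `v₁² + v₂²` (the norm instance of `ℝ × ℝ` is the
sup norm, so this is written out). [cite: Liu2015, §3.1 eq. (16)] -/
def sqLen (v : ℝ × ℝ) : ℝ := v.1 ^ 2 + v.2 ^ 2

/-- **The edge-mean-zero Poincaré (Crouzeix–Raviart interpolation) inequality with constant `κ`**, `C¹` special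
case: for every non-degenerate triangle `K = conv{a, b, c}` in `ℝ × ℝ` (twice the signed area
`(b − a)₁(c − a)₂ − (b − a)₂(c − a)₁ ≠ 0`) and every `f : ℝ × ℝ → ℝ` of class `C¹` whose mean over each of the
three edges vanishes (`∫₀¹ f(a + t(b − a)) dt = 0`, and cyclically), one has
`∫_K f² ≤ κ² · h_K² · ∫_K ((∂₁f)² + (∂₂f)²)`, where `h_K² = max` of the three squared edge lengths and the
integrals are against plane Lebesgue measure. Liu's `C(K) ≤ κ h_K` for all `K` [cite: Liu2015, §3.1 eq. (16)].
-- TODO(general form): the printed class is `f ∈ H¹(K)`; here `f ∈ C¹(ℝ²)` restricted to `K`. -/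
def CRPoincareConstant (κ : ℝ) : Prop :=
  ∀ (a b c : ℝ × ℝ), (b - a).1 * (c - a).2 - (b - a).2 * (c - a).1 ≠ 0 →
    ∀ (f : ℝ × ℝ → ℝ), ContDiff ℝ 1 f →
      (∫ t in (0 : ℝ)..1, f (a + t • (b - a))) = 0 →
      (∫ t in (0 : ℝ)..1, f (b + t • (c - b))) = 0 →
      (∫ t in (0 : ℝ)..1, f (c + t • (a - c))) = 0 →
        ∫ x in convexHull ℝ {a, b, c}, f x ^ 2
          ≤ κ ^ 2 * max (sqLen (b - a)) (max (sqLen (c - b)) (sqLen (a - c)))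
              * ∫ x in convexHull ℝ {a, b, c}, ((fderiv ℝ f x (1, 0)) ^ 2 + (fderiv ℝ f x (0, 1)) ^ 2)

/-- **Liu's Crouzeix–Raviart constant (named fact, hypothesis «H-CR»):** `C(K) ≤ 0.1893·h_K` for every triangle
`K`, i.e. `CRPoincareConstant 0.1893` — proved in the source by verified computation on reference triangles
(`θ ∈ (0, π/3]`, 60 sub-intervals) plus a perturbation estimate (Theorems 4.1–4.2).
[cite: Liu2015, §4 («C(K) ≤ 0.1893h») and §4.3] -/
def LiuCRConstant : Prop := CRPoincareConstant (1893 / 10000)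

/-- The inequality is monotone in the constant: `κ ≤ κ'`, `0 ≤ κ` and `CRPoincareConstant κ` give
`CRPoincareConstant κ'`. [cite: Liu2015, Remark 2.2] -/
theorem CRPoincareConstant.mono {κ κ' : ℝ} (hκ : 0 ≤ κ) (hle : κ ≤ κ') (h : CRPoincareConstant κ) :
    CRPoincareConstant κ' := by
  intro a b c hK f hf h1 h2 h3
  have hmain := h a b c hK f hf h1 h2 h3
  have hgrad : 0 ≤ ∫ x in convexHull ℝ {a, b, c}, ((fderiv ℝ f x (1, 0)) ^ 2 + (fderiv ℝ f x (0, 1)) ^ 2) :=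
    integral_nonneg fun x => by positivity
  have hh : 0 ≤ max (sqLen (b - a)) (max (sqLen (c - b)) (sqLen (a - c))) :=
    le_max_of_le_left (by unfold sqLen; positivity)
  have hsq : κ ^ 2 ≤ κ' ^ 2 := by nlinarith
  exact hmain.trans (mul_le_mul_of_nonneg_right (mul_le_mul_of_nonneg_right hsq hh) hgrad)

/-- **Liu's constant implies the analytic one (hypothesis «H-CR-A»):** `CRPoincareConstant 0.1893 → CRPoincareConstant
0.2983` (`0.2983·h_K` is the analytic bound of Carstensen–Gallistl quoted in [cite: Liu2015, Remark 2.2]; its own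
proof is not reproduced here). So any eigenvalue bracket valid under «H-CR-A» is also valid under «H-CR». -/
theorem crPoincareConstant_of_liu (h : LiuCRConstant) : CRPoincareConstant (2983 / 10000) :=
  CRPoincareConstant.mono (by norm_num) (by norm_num) h

end Literature.Analysis.ValidatedNumerics
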